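import Literature.Combinatorics.Optimization.ConvexBodyPsdLiftFactorization
import HarnessLib

/-!
# Spectrahedral lifts and sums of squares (Fawzi–Gouveia–Parrilo–Saunderson–Thomas 2022, §4.1:
# Theorem 4.1, Proposition 4.3 and the necessity statement (*-SDP)) — PROVED

Source: H. Fawzi, J. Gouveia, P. A. Parrilo, J. Saunderson, R. R. Thomas, *Lifting for simplicity:
concise descriptions of convex sets*, SIAM Review 64 (2022) 866–918 = arXiv:2002.09788
[FawziEtAl2022Lifting], §4.1 "Spectrahedral lifts and sums of squares" (held text
`paper:arxiv-2002.09788`, chunk p0020). Vocabulary of the tree: `HasPsdLift C k : C = π(S^k_+ ∩ L)`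
(FGPRT eq. (3), `PsdLiftSlackMatrix.lean`), the polar `polarInner C = {y | ⟪x, y⟫ ≤ 1 ∀ x ∈ C}`
(Rockafellar §14, `PolarsOfConvexSets.lean`), and Gouveia–Parrilo–Thomas' Theorem 2.4 for `S^k_+`
(`ConvexBodyPsdLiftFactorization.lean`), of which the present statements are the reformulation
printed in the survey.

[FawziEtAl2022Lifting, §4.1 p20], verbatim:

> **Theorem 4.1.** Let `C = conv(𝒳)` be a convex body. Then `C` has a spectrahedral lift of size
> `m` if, and only if, there exists a map `A : 𝒳 → S^m_+` such that the following holds: for any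
> `ℓ ∈ C°`, there exists a `B ∈ S^m_+` such that `1 − ℓ(x) = tr(A(x)B) ∀ x ∈ 𝒳`. (4.1)
> […] Equation (4.1) is nothing but a `S^m_+` factorization of this slack operator. […] if we
> factorize `A(x)` as `A(x) = F(x)F(x)ᵀ` and `B = DDᵀ` […] `1 − ℓ(x) = tr(A(x)B) = Σ_{i,j} M_{ij}(x)²`
> where `M(x) = F(x)ᵀD`. […] We have thus shown the following: if `C = conv(𝒳)` has a
> spectrahedral lift of size `m`, then there is a subspace `V` of functions on `𝒳` with
> `dim(V) ≤ m²` such that the following is true: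
> (*-SDP) For any valid linear inequality `ℓ(x) ≤ 1` on `𝒳`, there exist functions `h_k ∈ V`
> s.t. `1 − ℓ(x) = Σ_k h_k(x)²` for all `x ∈ 𝒳`.
> […] **Proposition 4.3.** Let `C = conv(𝒳)` be a convex body. Assume there exists a subspace
> `V` of functions on `𝒳` such that (*-SDP) is true. Then `C` has a spectrahedral lift of size
> `dim(V)`. *Proof.* […] Let `m = dim(V)`, `f_1, …, f_m` be a basis of `V` […] Define
> `A(x) = f(x)f(x)ᵀ ∈ S^m_+`. […] there exist vectors `b_k ∈ ℝᵐ` such that `h_k(x) = b_kᵀ f(x)`.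
> Then `1 − ℓ(x) = Σ_k h_k(x)² = Σ_k (b_kᵀ f(x))² = tr(f(x) f(x)ᵀ B)` where `B = Σ_k b_k b_kᵀ`. □

## What is proved here (no named facts)

`E` is a finite-dimensional real inner product space; `𝒳 ⊆ E` any set with `C = conv(𝒳)` a
convex body (`conv(𝒳)` compact with `0` in its interior); "`ℓ ∈ C°`" is `y ∈ polarInner C` with
`ℓ(x) = ⟪x, y⟫`; functions on `𝒳` are rendered as functions `E → ℝ` (values off `𝒳` irrelevant).

* `hasPsdLift_convexHull_iff_exists_factorMap` — **Theorem 4.1** (`m ≥ 1`): `conv(𝒳)` has a psd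
  lift of size `m` iff there is `A : 𝒳 → S^m_+` such that every `ℓ ∈ C°` has a `B ⪰ 0` with
  `1 − ℓ(x) = Tr(A(x)B)` on `𝒳`. ("⇒": GPT Thm. 2.4 "⇒" gives this on all of `C ⊇ 𝒳`; "⇐": the
  data restrict to a factorization of the slack operator on `ext(C) × ext(C°)` because
  `ext(conv 𝒳) ⊆ 𝒳`, and GPT Thm. 2.4 "⇐" applies.)
* `hasPsdLift_convexHull_of_sos` — **Proposition 4.3** with `V` presented by a spanning family
  `f_1, …, f_m`: if every `1 − ⟪·, y⟫`, `y ∈ C°`, is on `𝒳` a finite sum of squares of linear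
  combinations of the `f_i`, then `conv(𝒳)` has a psd lift of size `m` (`A(x) = f(x)f(x)ᵀ`,
  `B = Σ_k b_k b_kᵀ`).
* `exists_sos_subspace_of_hasPsdLift` — **(*-SDP)**: if a bounded `C` has a psd lift of size
  `m ≥ 1`, there are `m²` functions `g_{pq}` on `E` (entries of a factor `F(x)`,
  `A(x) = F(x)ᵀF(x)`) such that every `1 − ⟪·, y⟫`, `y ∈ C°`, is on `C` a sum of `m²` squares of
  functions in `V = span{g_{pq}}` (the entries of `F(x)Dᵀ`, `B(y) = DᵀD`), and
  `finrank_sos_subspace_le`: `dim V ≤ m²`.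

* `hasPsdLift_convexHull_iff_exists_factorMap_dotProduct`, `hasPsdLift_convexHull_of_sos_dotProduct`
  — Theorem 4.1 and Proposition 4.3 in coordinates `ℝⁿ = Fin n → ℝ` with the dot product and
  `C° = dualBody` (`CubeOctahedronDuality`), the form of the tree's psd-rank files (via
  `hasPsdLift_iff_exists_psd_factorization_dotProduct`).

NOT here: the examples of §4.1 (elliptope, theta bodies, Example 4.4 ff.) and §4.2.
-/

noncomputable section

open Matrix Set
open scoped MatrixOrder RealInnerProductSpace

namespace Literature.Combinatorics.Optimization

open Literature.Analysis.Convex.PolarsOfConvexSets (polarInner mem_polarInner_iff)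

variable {E : Type*} [NormedAddCommGroup E] [InnerProductSpace ℝ E]
variable {k : ℕ}

/-! ### Theorem 4.1 -/

/-- **FGPST Theorem 4.1** (§4.1 p20): for a convex body `C = conv(𝒳)` (`conv(𝒳)` compact,
`0 ∈ int conv(𝒳)`) and `m ≥ 1`, `C` has a spectrahedral lift of size `m` iff there is a map
`A : 𝒳 → S^m_+` such that for every `ℓ = ⟪·, y⟫`, `y ∈ C°`, some `B ⪰ 0` satisfies
`1 − ℓ(x) = Tr(A(x)B)` for all `x ∈ 𝒳`. "⇒" is Gouveia–Parrilo–Thomas Thm. 2.4 "⇒" (tree: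
`HasPsdLift.exists_psd_factorization_polarInner`, valid on all of `C ⊇ 𝒳`); "⇐" restricts the
data to `ext(C) × ext(C°)` (`ext(conv 𝒳) ⊆ 𝒳`) and applies Thm. 2.4 "⇐"
(`hasPsdLift_of_psd_factorization`). PROVED here.
[cite: FawziEtAl2022Lifting, §4.1 Thm. 4.1 (p20)]
[cite: GouveiaParriloThomas2013, Thm. 2.4 (§2, p05–p06)] -/
theorem hasPsdLift_convexHull_iff_exists_factorMap [FiniteDimensional ℝ E] {X : Set E}
    (hc : IsCompact (convexHull ℝ X)) (h0 : (0 : E) ∈ interior (convexHull ℝ X)) (hk : 1 ≤ k) :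
    HasPsdLift (convexHull ℝ X) k ↔ ∃ A : E → Matrix (Fin k) (Fin k) ℝ,
      (∀ x ∈ X, (A x).PosSemidef) ∧ ∀ y ∈ polarInner (convexHull ℝ X),
        ∃ B : Matrix (Fin k) (Fin k) ℝ, B.PosSemidef ∧
          ∀ x ∈ X, (A x * B).trace = 1 - ⟪x, y⟫ := by
  constructor
  · intro h
    obtain ⟨A, B, hA, hB, hAB⟩ := h.exists_psd_factorization_polarInner hk hc.isBounded
    exact ⟨A, fun x hx => hA x (subset_convexHull ℝ X hx), fun y hy =>
      ⟨B y, hB y hy, fun x hx => hAB x (subset_convexHull ℝ X hx) y hy⟩⟩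
  · rintro ⟨A, hA, hB⟩
    choose! B hBpsd hBtr using hB
    exact hasPsdLift_of_psd_factorization hc (convex_convexHull ℝ X) h0 (A := A) (B := B)
      (fun x hx => hA x (extremePoints_convexHull_subset hx))
      (fun y hy => hBpsd y (extremePoints_subset hy))
      fun x hx y hy => hBtr y (extremePoints_subset hy) x (extremePoints_convexHull_subset hx)

/-! ### Proposition 4.3: lifts from sums of squares in a subspace of functions -/

/-- `Tr(v vᵀ · Σ_j b_j b_jᵀ) = Σ_j (v ⬝ b_j)²`. [folklore] -/
private theorem trace_vecMulVec_mul_sum_vecMulVec {m J : ℕ} (v : Fin m → ℝ)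
    (b : Fin J → Fin m → ℝ) :
    (vecMulVec v v * ∑ j, vecMulVec (b j) (b j)).trace = ∑ j, (v ⬝ᵥ b j) ^ 2 := by
  rw [Finset.mul_sum, trace_sum]
  refine Finset.sum_congr rfl fun j _ => ?_
  rw [vecMulVec_mul_vecMulVec, trace_vecMulVec, dotProduct_smul, smul_eq_mul, sq]

/-- **FGPST Proposition 4.3** (§4.1 p20), with the subspace `V` presented by a spanning family
`f_1, …, f_m` of functions: let `C = conv(𝒳)` be a convex body (`conv(𝒳)` compact,
`0 ∈ int conv(𝒳)`). If for every `y ∈ C°` the function `1 − ⟪·, y⟫` is on `𝒳` a finite sum of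
squares `Σ_j (Σ_i b_{ji} f_i(x))²` of linear combinations of the `f_i` (property (*-SDP) for
`V = span{f_i}`), then `C` has a spectrahedral lift of size `m`: `A(x) = f(x)f(x)ᵀ ⪰ 0`,
`B = Σ_j b_j b_jᵀ ⪰ 0`, `Tr(A(x)B) = Σ_j (b_jᵀ f(x))²`, and Theorem 4.1 "⇐". PROVED here.
[cite: FawziEtAl2022Lifting, §4.1 Prop. 4.3 (p20)] -/
theorem hasPsdLift_convexHull_of_sos [FiniteDimensional ℝ E] {X : Set E} {m : ℕ}
    (hc : IsCompact (convexHull ℝ X)) (h0 : (0 : E) ∈ interior (convexHull ℝ X))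
    (f : Fin m → E → ℝ)
    (hsos : ∀ y ∈ polarInner (convexHull ℝ X), ∃ (J : ℕ) (b : Fin J → Fin m → ℝ),
      ∀ x ∈ X, 1 - ⟪x, y⟫ = ∑ j, (∑ i, b j i * f i x) ^ 2) :
    HasPsdLift (convexHull ℝ X) m := by
  classical
  -- `A(x) = f(x) f(x)ᵀ`
  let A : E → Matrix (Fin m) (Fin m) ℝ := fun x => vecMulVec (fun i => f i x) (fun i => f i x)
  have hA : ∀ x, (A x).PosSemidef := fun x => by
    have h := posSemidef_vecMulVec_self_star (R := ℝ) (fun i => f i x)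
    rwa [star_trivial] at h
  -- `B(y) = Σ_j b_j b_jᵀ`
  have hB : ∀ y ∈ polarInner (convexHull ℝ X), ∃ B : Matrix (Fin m) (Fin m) ℝ, B.PosSemidef ∧
      ∀ x ∈ X, (A x * B).trace = 1 - ⟪x, y⟫ := by
    intro y hy
    obtain ⟨J, b, hb⟩ := hsos y hy
    refine ⟨∑ j, vecMulVec (b j) (b j), posSemidef_sum _ fun j _ => ?_, fun x hx => ?_⟩
    · have h := posSemidef_vecMulVec_self_star (R := ℝ) (b j)
      rwa [star_trivial] at h
    · rw [trace_vecMulVec_mul_sum_vecMulVec, hb x hx]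
      refine Finset.sum_congr rfl fun j _ => ?_
      congr 1
      rw [dotProduct_comm]
      rfl
  choose! B hBpsd hBtr using hB
  exact hasPsdLift_of_psd_factorization hc (convex_convexHull ℝ X) h0 (A := A) (B := B)
    (fun x _ => hA x) (fun y hy => hBpsd y (extremePoints_subset hy))
    fun x hx y hy => hBtr y (extremePoints_subset hy) x (extremePoints_convexHull_subset hx)

/-! ### (*-SDP): a psd lift of size `m` gives sums of squares from an `m²`-dimensional subspace -/

/-- `Σ_{i,j} M_{ij}² = Tr(M Mᵀ)` for a real square matrix. [folklore] -/
private theorem sum_sq_eq_trace_mul_transpose (M : Matrix (Fin k) (Fin k) ℝ) :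
    ∑ i, ∑ j, M i j ^ 2 = (M * Mᵀ).trace := by
  simp only [Matrix.trace, Matrix.diag, Matrix.mul_apply, Matrix.transpose_apply, sq]

/-- **FGPST (*-SDP), the necessity direction of §4.1** (p20: "if `C = conv(𝒳)` has a
spectrahedral lift of size `m`, then there is a subspace `V` of functions on `𝒳` with
`dim(V) ≤ m²` such that […] for any valid linear inequality `ℓ(x) ≤ 1` on `𝒳`, there exist
functions `h_k ∈ V` s.t. `1 − ℓ(x) = Σ_k h_k(x)²` for all `x ∈ 𝒳`"): if a bounded `C` has a psd
lift of size `m ≥ 1`, there are `m²` functions `g_{(p,q)} : E → ℝ` — the entries of a factor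
`F(x)` with `A(x) = F(x)ᵀF(x)` of the Theorem 2.4 map `A` — such that for every `y ∈ C°` the
function `1 − ⟪·, y⟫` is on `C` the sum of the `m²` squares of the functions
`h_{(i,j)} = Σ_q D_{jq} g_{(i,q)} ∈ span{g}` (the entries of `F(x)Dᵀ`, where `B(y) = DᵀD`):
`Σ_{ij} h_{ij}(x)² = Tr(D F(x)ᵀ F(x) Dᵀ) = Tr(A(x)B(y)) = 1 − ⟪x, y⟫`. Typed for all of `C`
(hence for any `𝒳` with `conv 𝒳 = C`). PROVED here; `dim span{g} ≤ m²` is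
`finrank_sos_subspace_le`. [cite: FawziEtAl2022Lifting, §4.1 (*-SDP) (p20)]
[cite: GouveiaParriloThomas2013, Thm. 2.4 (§2, p05–p06)] -/
theorem exists_sos_subspace_of_hasPsdLift {C : Set E} (hC : HasPsdLift C k) (hk : 1 ≤ k)
    (hbdd : Bornology.IsBounded C) :
    ∃ g : Fin k × Fin k → E → ℝ, ∀ y ∈ polarInner C, ∃ h : Fin k × Fin k → E → ℝ,
      (∀ ij, h ij ∈ Submodule.span ℝ (Set.range g)) ∧
        ∀ x ∈ C, 1 - ⟪x, y⟫ = ∑ ij, h ij x ^ 2 := by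
  classical
  obtain ⟨A, B, hA, hB, hAB⟩ := hC.exists_psd_factorization_polarInner hk hbdd
  -- factors `A(x) = F(x)ᵀ F(x)` on `C` and `B(y) = D(y)ᵀ D(y)` on `C°`
  have hF : ∀ x : E, ∃ F : Matrix (Fin k) (Fin k) ℝ, x ∈ C → A x = star F * F := by
    intro x
    by_cases hx : x ∈ C
    · obtain ⟨F, hF⟩ := CStarAlgebra.nonneg_iff_eq_star_mul_self.mp (hA x hx).nonneg
      exact ⟨F, fun _ => hF⟩
    · exact ⟨0, fun h => absurd h hx⟩
  choose F hF using hF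
  have hD : ∀ y : E, ∃ D : Matrix (Fin k) (Fin k) ℝ, y ∈ polarInner C → B y = star D * D := by
    intro y
    by_cases hy : y ∈ polarInner C
    · obtain ⟨D, hD⟩ := CStarAlgebra.nonneg_iff_eq_star_mul_self.mp (hB y hy).nonneg
      exact ⟨D, fun _ => hD⟩
    · exact ⟨0, fun h => absurd h hy⟩
  choose D hD using hD
  -- `g_{(p,q)}(x) = F(x)_{pq}`, `h_{(i,j)}(x) = (F(x) D(y)ᵀ)_{ij}`
  let g : Fin k × Fin k → E → ℝ := fun pq x => F x pq.1 pq.2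
  have hmem : ∀ (y : E) (i j : Fin k),
      (fun x => (F x * (D y)ᵀ) i j) ∈ Submodule.span ℝ (Set.range g) := by
    intro y i j
    -- membership in the span: `h_{(i,j)} = Σ_q D_{jq} • g_{(i,q)}`
    have hfun : (fun x => (F x * (D y)ᵀ) i j) = ∑ q, D y j q • g (i, q) := by
      funext x
      simp only [g, Matrix.mul_apply, Matrix.transpose_apply, Finset.sum_apply, Pi.smul_apply,
        smul_eq_mul]
      exact Finset.sum_congr rfl fun q _ => mul_comm _ _
    rw [hfun]
    exact Submodule.sum_mem _ fun q _ =>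
      Submodule.smul_mem _ _ (Submodule.subset_span ⟨(i, q), rfl⟩)
  refine ⟨g, fun y hy => ⟨fun ij x => (F x * (D y)ᵀ) ij.1 ij.2, fun ij => hmem y ij.1 ij.2,
    fun x hx => ?_⟩⟩
  -- `Σ_{ij} h_{ij}(x)² = Tr(A(x) B(y))`
  rw [← hAB x hx y hy, hF x hx, hD y hy, Fintype.sum_prod_type]
  dsimp only
  rw [sum_sq_eq_trace_mul_transpose, transpose_mul, transpose_transpose, star_eq_conjTranspose,
    star_eq_conjTranspose, conjTranspose_eq_transpose_of_trivial,
    conjTranspose_eq_transpose_of_trivial]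
  -- `Tr(Fᵀ F Dᵀ D) = Tr(F Dᵀ (D Fᵀ))`
  rw [trace_mul_comm ((F x)ᵀ * F x), Matrix.mul_assoc (F x), trace_mul_comm (F x)]
  simp only [Matrix.mul_assoc]

omit [NormedAddCommGroup E] [InnerProductSpace ℝ E] in
/-- The subspace of (*-SDP) has dimension at most `m²`: a span of `m²` functions.
[cite: FawziEtAl2022Lifting, §4.1 (*-SDP) (p20)] -/
theorem finrank_sos_subspace_le (g : Fin k × Fin k → E → ℝ) :
    Module.finrank ℝ (Submodule.span ℝ (Set.range g)) ≤ k ^ 2 := by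
  have h := finrank_range_le_card (R := ℝ) g
  rw [Fintype.card_prod, Fintype.card_fin, ← sq] at h
  exact h

/-! ### Coordinates `ℝⁿ = Fin n → ℝ` with the dot product -/

section Coordinates

open Literature.Analysis.Convex.CubeOctahedronDuality (dualBody dualBody_antitone)

variable {n : ℕ}

/-- **FGPST Theorem 4.1 in coordinates** `ℝⁿ = Fin n → ℝ` (`ℓ(x) = x ⬝ᵥ y`, `y ∈ C° = dualBody C`):
for `conv(𝒳)` compact with `0` in its interior and `m ≥ 1`, `conv(𝒳)` has a psd lift of size `m`
iff some `A : 𝒳 → S^m_+` admits, for every `y ∈ C°`, a `B ⪰ 0` with `1 − x ⬝ᵥ y = Tr(A(x)B)` on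
`𝒳`. (Transport of Theorem 4.1 through `hasPsdLift_iff_exists_psd_factorization_dotProduct`.)
[cite: FawziEtAl2022Lifting, §4.1 Thm. 4.1 (p20)] -/
theorem hasPsdLift_convexHull_iff_exists_factorMap_dotProduct {X : Set (Fin n → ℝ)}
    (hc : IsCompact (convexHull ℝ X)) (h0 : (0 : Fin n → ℝ) ∈ interior (convexHull ℝ X))
    (hk : 1 ≤ k) :
    HasPsdLift (convexHull ℝ X) k ↔ ∃ A : (Fin n → ℝ) → Matrix (Fin k) (Fin k) ℝ,
      (∀ x ∈ X, (A x).PosSemidef) ∧ ∀ y ∈ dualBody (convexHull ℝ X),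
        ∃ B : Matrix (Fin k) (Fin k) ℝ, B.PosSemidef ∧
          ∀ x ∈ X, (A x * B).trace = 1 - x ⬝ᵥ y := by
  constructor
  · intro h
    obtain ⟨A, B, hA, hB, hAB⟩ := h.exists_psd_factorization_dualBody hk hc.isBounded
    exact ⟨A, fun x hx => hA x (subset_convexHull ℝ X hx), fun y hy =>
      ⟨B y, hB y hy, fun x hx => hAB x (subset_convexHull ℝ X hx) y hy⟩⟩
  · rintro ⟨A, hA, hB⟩
    choose! B hBpsd hBtr using hB
    exact (hasPsdLift_iff_exists_psd_factorization_dotProduct hc (convex_convexHull ℝ X) h0 hk).mpr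
      ⟨A, B, fun x hx => hA x (extremePoints_convexHull_subset hx),
        fun y hy => hBpsd y (extremePoints_subset hy),
        fun x hx y hy => hBtr y (extremePoints_subset hy) x (extremePoints_convexHull_subset hx)⟩

/-- **FGPST Proposition 4.3 in coordinates** `ℝⁿ = Fin n → ℝ`: if `conv(𝒳)` is compact with
`0` in its interior, `m ≥ 1`, and for every `y` with `x ⬝ᵥ y ≤ 1` on `𝒳` (`y ∈ dualBody 𝒳`, the
valid inequalities) the function `1 − (·) ⬝ᵥ y` is on `𝒳` a finite sum of squares of linear
combinations of given functions `f_1, …, f_m`, then `conv(𝒳)` has a psd lift of size `m`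
(`A(x) = f(x)f(x)ᵀ`, `B = Σ_j b_j b_jᵀ`). [cite: FawziEtAl2022Lifting, §4.1 Prop. 4.3 (p20)] -/
theorem hasPsdLift_convexHull_of_sos_dotProduct {X : Set (Fin n → ℝ)} {m : ℕ}
    (hc : IsCompact (convexHull ℝ X)) (h0 : (0 : Fin n → ℝ) ∈ interior (convexHull ℝ X))
    (hm : 1 ≤ m) (f : Fin m → (Fin n → ℝ) → ℝ)
    (hsos : ∀ y ∈ dualBody X, ∃ (J : ℕ) (b : Fin J → Fin m → ℝ),
      ∀ x ∈ X, 1 - x ⬝ᵥ y = ∑ j, (∑ i, b j i * f i x) ^ 2) :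
    HasPsdLift (convexHull ℝ X) m := by
  classical
  refine (hasPsdLift_convexHull_iff_exists_factorMap_dotProduct hc h0 hm).mpr
    ⟨fun x => vecMulVec (fun i => f i x) (fun i => f i x), fun x _ => ?_, fun y hy => ?_⟩
  · have h := posSemidef_vecMulVec_self_star (R := ℝ) (fun i => f i x)
    rwa [star_trivial] at h
  · obtain ⟨J, b, hb⟩ := hsos y (dualBody_antitone (subset_convexHull ℝ X) hy)
    refine ⟨∑ j, vecMulVec (b j) (b j), posSemidef_sum _ fun j _ => ?_, fun x hx => ?_⟩
    · have h := posSemidef_vecMulVec_self_star (R := ℝ) (b j)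
      rwa [star_trivial] at h
    · rw [trace_vecMulVec_mul_sum_vecMulVec, hb x hx]
      refine Finset.sum_congr rfl fun j _ => ?_
      congr 1
      rw [dotProduct_comm]
      rfl

end Coordinates

end Literature.Combinatorics.Optimization
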